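import Summits.QuantumFields.BalabanUV.T4Continuum.Support.NE7SliceLetterCover
import Summits.QuantumFields.BalabanUV.T4Continuum.Support.NE7SliceLetterHomFlatWitness
import Summits.QuantumFields.BalabanUV.T4Continuum.Support.NE3CovariantWeitzenbock
import Summits.QuantumFields.BalabanUV.T4Continuum.Support.BlockAveragePushDirGauge
import HarnessLib

/-!
# NE7SliceLetterFourTerm — THE TARGET SHAPE OF THE ONE REMAINING LETTER AFTER GEN 82's POWER COUNTING: the FOUR-TERM slice-solver letter
# `‖curl_W X‖ ≤ K_G·g + K_X·R + K_D·‖D_W^*(X + gaugeDir_W σ)‖_∞ + K_Ξ·‖σ‖_∞` (every skew periodic gauge parameter `σ`), TYPED; it lifts down from every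
# cover of the torus; with a fixed `σ₀` it is F142's set-letter shape with an additive constant; and it is INHABITED at the flat background with `(K·L^{j+1}, 0, 0, 0)`
# (file 82 of the curved (APE), F152)

Cell `pub-balaban`, rung (B)+1 sub-cell t4, lineage `b2b-balaban-t4-ne7-p1` (CRUX PROVER NE7 #1 = OWNER of row NE7), generation 82; memo
`t4/b2b-balaban-t4-ne7-p1-g82/LOCALISATION-ROAD.md` §2(d), O2.  Over F149 `NE7SliceLetterCover` (`hessFunctional_cover`), lineage #2's flat witness via F138
`NE7SliceLetterHomFlatWitness.homSliceLetter_flatCfg`, row NE3's `NE3CovariantWeitzenbock.covDiv` (`D_W^*`) and `BlockAveragePushDirGauge.gaugeDir`.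
WHY.  The memo's transfer «hard slice ⟸ soft rows» (algebraic skeleton F151 `NE7ConstrainedGreenGaugeSplit.eq_fourTerm`: `x = C h + C D(Dᵀ(x + Dσ)) − (Dσ − H(QDσ)) + C(S₀Dσ)`)
produces, from the four analytic rows of the soft operator, EXACTLY a letter of this shape: the source row gives `K_G·g`, the representative's sup enters only through lower-order
background terms (`K_X ≲ E∕M`), the DIVERGENCE of the re-gauged field `X + gaugeDir_W σ` is priced by `K_D` (massive scalar propagator rows — (H0_W), in the tree), and the known
gauge part `σ` by `K_Ξ ≍ x + K_G·τ_W` (`ad(flux)` + tension, as in F142's `2(x + K_G τ_W)C_ξ`).  The END's field is ONE field `A − A_N` whose gauge part `σ̃` the END KNOWS (road (B)'s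
block-constant extension, `‖σ̃‖ ≤ 2θ_u`) — so it will supply `σ := σ̃` and a divergence datum; this file fixes the shape both sides (analysis, END re-thread) must meet.
WHAT ([folklore]; 0 def, 0 sorry).  §1 **`sliceLetterE_cover`** — F149's cover transfer for the shape `K_G·g + K_X·R + E` (an additive background constant `E`), any period-free
side condition; §2 **`fourTermLetter_cover`** — the four-term letter at period `L^{k+1}·(N·m)` implies it at period `L^{k+1}·N` (the gauge parameter and the divergence datum do not
see the period); §3 **`setLetterE_of_fourTerm`** — for a FIXED skew periodic `σ₀` with `‖σ₀‖ ≤ Ξ₀` and a divergence budget `D₀`, the four-term letter gives F142's `hGL`-shaped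
letter on the set `{X : ‖D_W^*(X + gaugeDir_W σ₀)‖_∞ ≤ D₀}` with the additive constant `E = K_D·D₀ + K_Ξ·Ξ₀`; §4 **`fourTermLetter_flatCfg`** — NON-VACUITY: at `W = 1` the
four-term letter holds with `(K·L^{j+1}, 0, 0, 0)` for every `N ≥ 1`, `j` (`d ≥ 2`, `L ≥ 2`; lineage #2's (152) through F138).
HONEST FRAMING (page 1): bookkeeping; the four-term letter at a CURVED background is NOT proved here (it is the memo's programme P2: O1 flat rows of the contour-mass soft
operator, the bootstrap, (E_W)); nothing of Bałaban's asserted; (APE) on curved data NOT proved; NOT ONE-STEP, NOT NE7; spine 0∕9; finite T⁴ rung (B)+1 — NOT infinite volume,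
NOT mass gap, NOT `BetaPertH`, NOT Clay.  Continuum YM on T⁴ ⇐ BetaPertH ∧ nine spine estimates (0/9 proved); BetaPertH ⇐ (D1) ∧ (D4) ∧ CAP+tail; G-an2-4 gates asym, D1 and
NE2/3/4.
-/

set_option autoImplicit false

open scoped BigOperators Matrix.Norms.L2Operator
open Finset

namespace Summit.QuantumFields.BalabanUV.T4Continuum.NE7SliceLetterFourTerm

open Literature.MathematicalPhysics.QuantumFieldTheory.Balaban1983to89
open B7Prop1Explicit B7Prop2Explicit UnitaryModel
open T4AveragingDeficitWall (IsUnitaryCfg IsSkewDir SmallField curlAt dirL1)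
open T4AveragingDeficitWallBoundary (IsPeriodicCfg periodBox)
open AveragingDeficitPeriodicCounting (IsPeriodicDir)
open AveragingDeficitMultiLevelPrep (LevelSmall)
open MinimalActionLevels (perWin)
open MinimalActionWitness (flatCfg)
open BlockAveragePushDirGauge (gaugeDir)
open NE3CovariantWeitzenbock (covDiv)
open NE3HessForm (hess)
open NE3TangentCovariantTower (dirIter)
open NE7TangentCriticalCover (isPeriodicCfg_mul isPeriodicDir_mul)
open NE7SliceLetterCover (hessFunctional_cover)
open NE7SliceLetterHomFlatWitness (homSliceLetter_flatCfg)
open PeriodicChoice (periodic_vec)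

noncomputable section

variable {d : ℕ} {n : Type*} [Fintype n] [DecidableEq n]

/-! ## §1 The cover transfer for the shape `K_G·g + K_X·R + E` -/

/-- **THE SLICE-SOLVER LETTER WITH AN ADDITIVE BACKGROUND CONSTANT LIFTS DOWN FROM THE `m`-FOLD COVER** (F149's `sliceLetter_cover` for the conclusion
`K_G·g + K_X·R + E`, any period-free side condition `C`). [folklore] -/
theorem sliceLetterE_cover [Nonempty n] {L : ℕ} (hL : 1 ≤ L) (k : ℕ) {N : ℕ} (hN : 1 ≤ N) {m : ℕ} (hm : 1 ≤ m)
    {W : Site d → Fin d → (Matrix n n ℂ)ˣ} (hWu : IsUnitaryCfg W) {x : ℝ} (hx : 0 ≤ x) (hs : LevelSmall d L k x) (hWx : SmallField W x)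
    (hWP : IsPeriodicCfg W ((L ^ (k + 1) * N : ℕ) : ℤ))
    (C : (Site d → Fin d → Matrix n n ℂ) → Prop) {KG KX E : ℝ}
    (hbig : ∀ X : Site d → Fin d → Matrix n n ℂ, IsSkewDir X → C X →
      IsPeriodicDir X ((L ^ (k + 1) * (N * m) : ℕ) : ℤ) → dirIter L (k + 1) W X = 0 → ∀ R : ℝ, (∀ y κ', ‖X y κ'‖ ≤ R) → ∀ g : ℝ, 0 ≤ g →
      (∀ Y : Site d → Fin d → Matrix n n ℂ, IsSkewDir Y → IsPeriodicDir Y ((L ^ (k + 1) * (N * m) : ℕ) : ℤ) → dirIter L (k + 1) W Y = 0 →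
        |hess W X Y (perWin d (L ^ (k + 1) * (N * m)))| ≤ g * dirL1 Y (periodBox (d := d) (L ^ (k + 1) * (N * m)))) →
      ∀ z μ' ν', μ' ≠ ν' → ‖curlAt W X z μ' ν'‖ ≤ KG * g + KX * R + E) :
    ∀ X : Site d → Fin d → Matrix n n ℂ, IsSkewDir X → C X →
      IsPeriodicDir X ((L ^ (k + 1) * N : ℕ) : ℤ) → dirIter L (k + 1) W X = 0 → ∀ R : ℝ, (∀ y κ', ‖X y κ'‖ ≤ R) → ∀ g : ℝ, 0 ≤ g →
      (∀ Y : Site d → Fin d → Matrix n n ℂ, IsSkewDir Y → IsPeriodicDir Y ((L ^ (k + 1) * N : ℕ) : ℤ) → dirIter L (k + 1) W Y = 0 →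
        |hess W X Y (perWin d (L ^ (k + 1) * N))| ≤ g * dirL1 Y (periodBox (d := d) (L ^ (k + 1) * N))) →
      ∀ z μ' ν', μ' ≠ ν' → ‖curlAt W X z μ' ν'‖ ≤ KG * g + KX * R + E := by
  intro X hXs hXC hXP hXT R hXR g hg hXg z μ' ν' hne
  have hXPm : IsPeriodicDir X ((L ^ (k + 1) * (N * m) : ℕ) : ℤ) := by
    have h := isPeriodicDir_mul hXP (m : ℤ)
    push_cast at h ⊢
    rw [mul_assoc] at h
    exact h
  exact hbig X hXs hXC hXPm hXT R hXR g hg (hessFunctional_cover hL k hN hm hWu hx hs hWx hWP hXP hg hXg) z μ' ν' hne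

/-! ## §2 The four-term letter lifts down from every cover -/

omit [Fintype n] [DecidableEq n] in
/-- A `P`-periodic site scalar is `P·m`-periodic. [folklore] -/
theorem scalar_periodic_mul {σ : Site d → Matrix n n ℂ} {P : ℤ} (hσ : ∀ (y : Site d) (i : Fin d), σ (y + P • e i) = σ y) (m : ℤ) :
    ∀ (y : Site d) (i : Fin d), σ (y + (P * m) • e i) = σ y := by
  intro y i
  have h := periodic_vec (g := σ) (N := P) hσ y (m • e i)
  rwa [smul_smul] at h

/-- **THE FOUR-TERM SLICE-SOLVER LETTER LIFTS DOWN FROM THE `m`-FOLD COVER.**  Fix unitary `W` of period `L^{k+1}·N` in the multi-level small-field class and constants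
`(K_G, K_X, K_D, K_Ξ)`.  If «for every skew `W`-tangent `X` of period `Q` with `‖X‖_∞ ≤ R` and `ℓ¹`-dual slice bound `g` on the `Q`-periodic tangent tests, every skew `Q`-periodic gauge
parameter `σ` with `‖σ‖_∞ ≤ Ξ`, and every bound `D` of `‖D_W^*(X + gaugeDir_W σ)‖_∞`: `‖curl_W X‖ ≤ K_G·g + K_X·R + K_D·D + K_Ξ·Ξ`» holds at `Q = L^{k+1}·(N·m)` (`m ≥ 1`), then it
holds at `Q = L^{k+1}·N`. [folklore] -/
theorem fourTermLetter_cover [Nonempty n] {L : ℕ} (hL : 1 ≤ L) (k : ℕ) {N : ℕ} (hN : 1 ≤ N) {m : ℕ} (hm : 1 ≤ m)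
    {W : Site d → Fin d → (Matrix n n ℂ)ˣ} (hWu : IsUnitaryCfg W) {x : ℝ} (hx : 0 ≤ x) (hs : LevelSmall d L k x) (hWx : SmallField W x)
    (hWP : IsPeriodicCfg W ((L ^ (k + 1) * N : ℕ) : ℤ)) {KG KX KD KΞ : ℝ}
    (hbig : ∀ X : Site d → Fin d → Matrix n n ℂ, IsSkewDir X →
      IsPeriodicDir X ((L ^ (k + 1) * (N * m) : ℕ) : ℤ) → dirIter L (k + 1) W X = 0 → ∀ R : ℝ, (∀ y κ', ‖X y κ'‖ ≤ R) → ∀ g : ℝ, 0 ≤ g →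
      (∀ Y : Site d → Fin d → Matrix n n ℂ, IsSkewDir Y → IsPeriodicDir Y ((L ^ (k + 1) * (N * m) : ℕ) : ℤ) → dirIter L (k + 1) W Y = 0 →
        |hess W X Y (perWin d (L ^ (k + 1) * (N * m)))| ≤ g * dirL1 Y (periodBox (d := d) (L ^ (k + 1) * (N * m)))) →
      ∀ σ : Site d → Matrix n n ℂ, (∀ y, σ y ∈ skewAdjoint (Matrix n n ℂ)) →
      (∀ (y : Site d) (i : Fin d), σ (y + ((L ^ (k + 1) * (N * m) : ℕ) : ℤ) • e i) = σ y) → ∀ Ξ : ℝ, (∀ y, ‖σ y‖ ≤ Ξ) →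
      ∀ D : ℝ, (∀ y, ‖covDiv W (fun z κ => X z κ + gaugeDir W σ z κ) y‖ ≤ D) →
      ∀ z μ' ν', μ' ≠ ν' → ‖curlAt W X z μ' ν'‖ ≤ KG * g + KX * R + KD * D + KΞ * Ξ) :
    ∀ X : Site d → Fin d → Matrix n n ℂ, IsSkewDir X →
      IsPeriodicDir X ((L ^ (k + 1) * N : ℕ) : ℤ) → dirIter L (k + 1) W X = 0 → ∀ R : ℝ, (∀ y κ', ‖X y κ'‖ ≤ R) → ∀ g : ℝ, 0 ≤ g →
      (∀ Y : Site d → Fin d → Matrix n n ℂ, IsSkewDir Y → IsPeriodicDir Y ((L ^ (k + 1) * N : ℕ) : ℤ) → dirIter L (k + 1) W Y = 0 →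
        |hess W X Y (perWin d (L ^ (k + 1) * N))| ≤ g * dirL1 Y (periodBox (d := d) (L ^ (k + 1) * N))) →
      ∀ σ : Site d → Matrix n n ℂ, (∀ y, σ y ∈ skewAdjoint (Matrix n n ℂ)) →
      (∀ (y : Site d) (i : Fin d), σ (y + ((L ^ (k + 1) * N : ℕ) : ℤ) • e i) = σ y) → ∀ Ξ : ℝ, (∀ y, ‖σ y‖ ≤ Ξ) →
      ∀ D : ℝ, (∀ y, ‖covDiv W (fun z κ => X z κ + gaugeDir W σ z κ) y‖ ≤ D) →
      ∀ z μ' ν', μ' ≠ ν' → ‖curlAt W X z μ' ν'‖ ≤ KG * g + KX * R + KD * D + KΞ * Ξ := by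
  intro X hXs hXP hXT R hXR g hg hXg σ hσs hσP Ξ hσΞ D hD z μ' ν' hne
  have hXPm : IsPeriodicDir X ((L ^ (k + 1) * (N * m) : ℕ) : ℤ) := by
    have h := isPeriodicDir_mul hXP (m : ℤ)
    push_cast at h ⊢
    rw [mul_assoc] at h
    exact h
  have hσPm : ∀ (y : Site d) (i : Fin d), σ (y + ((L ^ (k + 1) * (N * m) : ℕ) : ℤ) • e i) = σ y := by
    have h := scalar_periodic_mul hσP (m : ℤ)
    push_cast at h ⊢
    rw [mul_assoc] at h
    exact h
  exact hbig X hXs hXPm hXT R hXR g hg (hessFunctional_cover hL k hN hm hWu hx hs hWx hWP hXP hg hXg) σ hσs hσPm Ξ hσΞ D hD z μ' ν' hne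

/-! ## §3 With a fixed gauge parameter: F142's set-letter shape with an additive constant -/

/-- **THE FOUR-TERM LETTER READ ON A DIVERGENCE CLASS**: for a FIXED skew `Q`-periodic gauge parameter `σ₀` with `‖σ₀‖_∞ ≤ Ξ₀` and a budget `D₀`, the four-term letter gives the
`hGL`-shaped letter of F142 (`NE7SliceLetterHodgeReductionSplit`) on the set `S_L = {X : ‖D_W^*(X + gaugeDir_W σ₀)‖_∞ ≤ D₀}` with the additive constant `E = K_D·D₀ + K_Ξ·Ξ₀`. [folklore] -/
theorem setLetterE_of_fourTerm {L : ℕ} (k : ℕ) {Q : ℕ} {W : Site d → Fin d → (Matrix n n ℂ)ˣ} {KG KX KD KΞ : ℝ}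
    (h4 : ∀ X : Site d → Fin d → Matrix n n ℂ, IsSkewDir X →
      IsPeriodicDir X (Q : ℤ) → dirIter L (k + 1) W X = 0 → ∀ R : ℝ, (∀ y κ', ‖X y κ'‖ ≤ R) → ∀ g : ℝ, 0 ≤ g →
      (∀ Y : Site d → Fin d → Matrix n n ℂ, IsSkewDir Y → IsPeriodicDir Y (Q : ℤ) → dirIter L (k + 1) W Y = 0 →
        |hess W X Y (perWin d Q)| ≤ g * dirL1 Y (periodBox (d := d) Q)) →
      ∀ σ : Site d → Matrix n n ℂ, (∀ y, σ y ∈ skewAdjoint (Matrix n n ℂ)) →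
      (∀ (y : Site d) (i : Fin d), σ (y + (Q : ℤ) • e i) = σ y) → ∀ Ξ : ℝ, (∀ y, ‖σ y‖ ≤ Ξ) →
      ∀ D : ℝ, (∀ y, ‖covDiv W (fun z κ => X z κ + gaugeDir W σ z κ) y‖ ≤ D) →
      ∀ z μ' ν', μ' ≠ ν' → ‖curlAt W X z μ' ν'‖ ≤ KG * g + KX * R + KD * D + KΞ * Ξ)
    {σ₀ : Site d → Matrix n n ℂ} (hσ₀s : ∀ y, σ₀ y ∈ skewAdjoint (Matrix n n ℂ)) (hσ₀P : ∀ (y : Site d) (i : Fin d), σ₀ (y + (Q : ℤ) • e i) = σ₀ y)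
    {Ξ₀ : ℝ} (hΞ₀ : ∀ y, ‖σ₀ y‖ ≤ Ξ₀) (D₀ : ℝ) :
    ∀ X ∈ {X : Site d → Fin d → Matrix n n ℂ | IsSkewDir X ∧ ∀ y, ‖covDiv W (fun z κ => X z κ + gaugeDir W σ₀ z κ) y‖ ≤ D₀},
      IsPeriodicDir X (Q : ℤ) → dirIter L (k + 1) W X = 0 → ∀ R : ℝ, (∀ y κ', ‖X y κ'‖ ≤ R) → ∀ g : ℝ, 0 ≤ g →
      (∀ Y : Site d → Fin d → Matrix n n ℂ, IsSkewDir Y → IsPeriodicDir Y (Q : ℤ) → dirIter L (k + 1) W Y = 0 →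
        |hess W X Y (perWin d Q)| ≤ g * dirL1 Y (periodBox (d := d) Q)) →
      ∀ z μ' ν', μ' ≠ ν' → ‖curlAt W X z μ' ν'‖ ≤ KG * g + KX * R + (KD * D₀ + KΞ * Ξ₀) := by
  intro X hX hXP hXT R hXR g hg hXg z μ' ν' hne
  obtain ⟨hXs, hXD⟩ := hX
  have h := h4 X hXs hXP hXT R hXR g hg hXg σ₀ hσ₀s hσ₀P Ξ₀ hΞ₀ D₀ hXD z μ' ν' hne
  linarith

/-! ## §4 Non-vacuity: the four-term letter at the flat background -/

/-- **THE FOUR-TERM LETTER HOLDS AT `W = 1` WITH `(K·L^{j+1}, 0, 0, 0)`** for every `N ≥ 1` and `j` (`d ≥ 2`, `L ≥ 2`; `K ≥ 0` free of `N`, `j`): lineage #2's flat slice-solver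
theorem (152) through F138 `homSliceLetter_flatCfg` — at the flat background the letter is divergence-blind and gauge-blind, as the memo's §2(d) says it must be.
[cite: Balaban1984PropagatorsI, (1.103) p.34, (1.115) p.36] -/
theorem fourTermLetter_flatCfg {m : Type} [Fintype m] [DecidableEq m] [Nonempty m] (hd : 2 ≤ d) {L : ℕ} (hL : 2 ≤ L) :
    ∃ K : ℝ, 0 ≤ K ∧ ∀ (N : ℕ) [NeZero N] (j : ℕ),
      ∀ X : Site d → Fin d → Matrix m m ℂ, IsSkewDir X →
        IsPeriodicDir X ((N * L ^ (j + 1) : ℕ) : ℤ) → dirIter L (j + 1) (flatCfg : Site d → Fin d → (Matrix m m ℂ)ˣ) X = 0 →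
        ∀ R : ℝ, (∀ y κ', ‖X y κ'‖ ≤ R) → ∀ g : ℝ, 0 ≤ g →
        (∀ Y : Site d → Fin d → Matrix m m ℂ, IsSkewDir Y → IsPeriodicDir Y ((N * L ^ (j + 1) : ℕ) : ℤ) →
          dirIter L (j + 1) (flatCfg : Site d → Fin d → (Matrix m m ℂ)ˣ) Y = 0 →
          |hess (flatCfg : Site d → Fin d → (Matrix m m ℂ)ˣ) X Y (perWin d (N * L ^ (j + 1)))| ≤ g * dirL1 Y (periodBox (d := d) (N * L ^ (j + 1)))) →
        ∀ σ : Site d → Matrix m m ℂ, (∀ y, σ y ∈ skewAdjoint (Matrix m m ℂ)) →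
        (∀ (y : Site d) (i : Fin d), σ (y + ((N * L ^ (j + 1) : ℕ) : ℤ) • e i) = σ y) → ∀ Ξ : ℝ, (∀ y, ‖σ y‖ ≤ Ξ) →
        ∀ D : ℝ, (∀ y, ‖covDiv (flatCfg : Site d → Fin d → (Matrix m m ℂ)ˣ) (fun z κ => X z κ + gaugeDir (flatCfg : Site d → Fin d → (Matrix m m ℂ)ˣ) σ z κ) y‖ ≤ D) →
        ∀ (z : Site d) (μ' ν' : Fin d), μ' ≠ ν' →
          ‖curlAt (flatCfg : Site d → Fin d → (Matrix m m ℂ)ˣ) X z μ' ν'‖ ≤ (K * (L : ℝ) ^ (j + 1)) * g + 0 * R + 0 * D + 0 * Ξ := by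
  obtain ⟨K, hK, h⟩ := homSliceLetter_flatCfg (n := m) hd hL
  refine ⟨K, hK, fun N _ j X hX hXP hX0 R hR g hg hH _ _ _ _ _ _ _ z μ' ν' hne => ?_⟩
  have h1 := h N j X hX hXP hX0 R hR g hg hH z μ' ν' hne
  simpa only [zero_mul, add_zero] using h1

end

end Summit.QuantumFields.BalabanUV.T4Continuum.NE7SliceLetterFourTerm
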